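import Summits.BirchSwinnertonDyer.BirchSwinnertonDyer.Theorems.PrintCFramBottomClassIndexLawFiveLeBorelDescentAssembly
import HarnessLib

/-!
# Route `PrintCFram`, crux C2 `BottomClassIndexLawFiveLe` (stmt-BirchSwinnertonDyer-20372), line
# `eisenstein-resource-bdp-line`, stub `stub_kolyvaginUpper_borelCM_pairSum_offKrizLi`:
# **THE BOREL ČEBOTAREV DATA ON `H¹(K, W[p^M])` AS ONE EXISTENTIAL PACKAGE** (`dp`, `TopIndep`, (B1)–(B4)), and
# **the VERBATIM exponent `p^{2M₀}` on the `ε`-part under one even-depth derived class**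
# (cell `bsd-print-cfram`, seat `bsd-line-cfram-p1-w2` g7; helper `--supports` 20372; 0 facts, 0 defs, 0 sorry)

HONEST FRAMING. Nothing about BSD is proved here, and nothing of the stub itself. `…BorelDescentAssembly` proved
`p^{2M₀+1}·Sel ⊆ ℤx` on `H¹(K, W[p^M])` by constructing, inside one proof, the Čebotarev-side data of the abstract
Borel descent. This file EXPOSES that construction once, so that every theorem of `…BorelDescentClaimA/B/Annihilation`
(Claim A, `claimB_core`, the sharp variants) can be applied on `H¹(K, W[p^M])` without re-deriving it:

* **`exists_borelCebotarevData_of_cmRamified`** — for the CM class at the ramified prime (`𝓞_𝔭`-structure, `K`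
  imaginary quadratic with `−p` a non-square, complex conjugation `c` with LINE SIGN `ε`, `M ≥ 1`, `x` with
  `p^{M−1}x ≠ 0` and `c_* x = ε x`), there are `dp : V → ℕ` and `TopIndep : V → V → Prop` with: `hdp`
  (`p^a u = 0 ↔ dp u ≤ 2a`), `dp u = e` for every exact depth `e` of `u`, (B4) `hsplit`, (B1) `hceb1`, (B2) `hceb2`,
  (B3) `hceb3` — in the currency `Kol ℓ = IsKolyvaginPrime N W K p ℓ ∧ FrobEqFrobInfty W K (p^M) ℓ`,
  `A ℓ = ⨅_{v ∋ ℓ} torsionLocalKer v`. No Selmer data enter. Conditional on `chebotarev_artinRep` only.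
* **`pow_zsmul_eigen_mem_zmultiples_of_cmRamified_of_even`** — with the leaves as in `…BorelDescentAssembly`: if ONE
  Kolyvagin prime `ℓ` with `ord d(ℓ)_λ = p^{M−M₀}` (`p^{M−M₀−1} c(ℓ) ∉ Loc λ`) carries a class `c(ℓ)` of EVEN exact
  depth, then the `ε`-component `u(s + ε c_* s)` of every `s ∈ Sel` satisfies `p^{2M₀} u(s + ε c_* s) ∈ ℤx` —
  McCallum's exponent VERBATIM at the Borel prime (`pow_zsmul_eigen_mem_zmultiples_borel_of_even`).

THEOREMS ONLY; no definition, no named fact introduced, no `sorry`. BSD is not proved by any of this; no summit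
statement is proved by this seat. References: [McCallumLMS1991] §§3–5; [GrossLMS1991] §10.
-/

set_option autoImplicit false
-- `…BirchSwinnertonDyer.BirchSwinnertonDyer.Theorems…` is the problem's mandated namespace (D-0017).
set_option linter.dupNamespace false

noncomputable section

open scoped Classical

namespace Summit.BirchSwinnertonDyer.BirchSwinnertonDyer.Theorems.PrintCFram.BorelKolyvaginPairing

open WeierstrassCurve NumberField IsDedekindDomain Field Literature.NumberTheory.EllipticCurves
  Literature.NumberTheory.GaloisRepresentations Literature.NumberTheory.EllipticCurves.Rank1Residual
  Literature.NumberTheory.EllipticCurves.KolyvaginDescent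
  Summit.BirchSwinnertonDyer.BirchSwinnertonDyer.Theorems.PrintCFram.BorelHomothety
  Summit.BirchSwinnertonDyer.BirchSwinnertonDyer.Theorems.PrintCFram.BorelDescent

variable (W : WeierstrassCurve ℚ) [W.IsElliptic] (p : ℕ) [hp : Fact p.Prime]
variable {K : Type} [Field K] [NumberField K] {Pl : Type*}

/-- **The Borel Čebotarev data on `H¹(K, W[p^M])`, packaged.** See the module docstring. The six conjuncts are, in
order: `hdp`; uniqueness of the exact depth; (B4) `hsplit`; (B1) `hceb1`; (B2) `hceb2`; (B3) `hceb3` — literally the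
Čebotarev-side hypotheses of `…BorelDescentClaimA/B` with `τ = conjAct W c`, `Kol ℓ = IsKolyvaginPrime ∧ FrobEqFrobInfty`,
`A ℓ = ⨅_{v ∋ ℓ} torsionLocalKer v`. [cite: McCallumLMS1991, §3 Cor. 3.2] [cite: GrossLMS1991, Prop. 9.1] -/
theorem exists_borelCebotarevData_of_cmRamified
    (hC : Literature.NumberTheory.Automorphic.chebotarev_artinRep) {N : ℕ} [NeZero N]
    (hCM : W.HasCM) (h5 : 5 ≤ p) (hram : CMRamified W p)
    {s₀ : AlgebraicClosure ℚ} {μ : AddMonoid.End W.geomPoints} {m : ℤ}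
    (hs : s₀ ^ 2 = ((-(p : ℤ) : ℤ) : AlgebraicClosure ℚ)) (hm : m.natAbs = p)
    (hμμ : ∀ P, μ (μ P) = m • P)
    (hcomm : ∀ g : absoluteGaloisGroup ℚ, g • s₀ = s₀ → ∀ P, μ (g • P) = g • μ P)
    (hanti : ∀ g : absoluteGaloisGroup ℚ, g • s₀ = -s₀ → ∀ P, μ (g • P) = -(g • μ P))
    (hK : IsImaginaryQuadratic K) (hKp : ∀ y : K, y ^ 2 ≠ -(p : K)) {M : ℕ} (hM : 1 ≤ M)
    {cK : K ≃ₐ[ℚ] K} {c₀ : absoluteGaloisGroup ℚ} (hc₀ : IsComplexConjugation (Rat.castHom ℝ) c₀)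
    (ht : IsLiftOfAut cK (absGaloisTransport (K := ℚ) (L := K) c₀).toRingEquiv)
    {ε : ℤ} (hε : ε = 1 ∨ ε = -1) (hη : ∀ P : W.geomPoints, μ P = 0 → c₀ • P = ε • P)
    {xc : galH1Torsion (W.baseChange K) ((p ^ M : ℕ) : ℤ)}
    (hxord : ((p : ℤ) ^ (M - 1)) • xc ≠ 0) (hτx : conjAct W cK ((p ^ M : ℕ) : ℤ) xc = ε • xc) :
    ∃ (dp : galH1Torsion (W.baseChange K) ((p ^ M : ℕ) : ℤ) → ℕ) (TopIndep : galH1Torsion (W.baseChange K) ((p ^ M : ℕ) : ℤ) → galH1Torsion (W.baseChange K) ((p ^ M : ℕ) : ℤ) → Prop),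
      (∀ (u : galH1Torsion (W.baseChange K) ((p ^ M : ℕ) : ℤ)) (a : ℕ), ((p : ℤ) ^ a) • u = 0 ↔ dp u ≤ 2 * a) ∧
      (∀ (u : galH1Torsion (W.baseChange K) ((p ^ M : ℕ) : ℤ)) (e : ℕ),
        (∀ ρ ∈ torsionFixing (W.baseChange K) ((p ^ M : ℕ) : ℤ), (μ ^ e) ((RatClosure.torsionEquiv (K := K) W ((p ^ M : ℕ) : ℤ)).symm
          (h1Eval (W.baseChange K) ((p ^ M : ℕ) : ℤ) u ρ) : W.geomPoints) = 0) →
        (∃ ρ ∈ torsionFixing (W.baseChange K) ((p ^ M : ℕ) : ℤ), (μ ^ (e - 1)) ((RatClosure.torsionEquiv (K := K) W ((p ^ M : ℕ) : ℤ)).symm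
          (h1Eval (W.baseChange K) ((p ^ M : ℕ) : ℤ) u ρ) : W.geomPoints) ≠ 0) → dp u = e) ∧
      (∀ z : galH1Torsion (W.baseChange K) ((p ^ M : ℕ) : ℤ), conjAct W cK ((p ^ M : ℕ) : ℤ) z = ε • z →
        ∃ (k : ℤ) (z' : galH1Torsion (W.baseChange K) ((p ^ M : ℕ) : ℤ)), z = k • xc + z' ∧ TopIndep xc z') ∧
      (∀ (u : galH1Torsion (W.baseChange K) ((p ^ M : ℕ) : ℤ)) (Nu : ℕ), u ≠ 0 → conjAct W cK ((p ^ M : ℕ) : ℤ) u = ε • u →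
        2 * Nu ≤ dp u + 1 → ∀ b : ℕ, ∃ ℓ, b < ℓ ∧ (IsKolyvaginPrime N W K p ℓ ∧ FrobEqFrobInfty W K (p ^ M) ℓ) ∧
          ((p : ℤ) ^ Nu) • u ∈ (⨅ (v : HeightOneSpectrum (𝓞 K)) (_ : (ℓ : 𝓞 K) ∈ v.asIdeal),
            (W.baseChange K).torsionLocalKer (v.adicCompletion K) ((p ^ M : ℕ) : ℤ)) ∧
          (Nu ≠ 0 → ((p : ℤ) ^ (Nu - 1)) • u ∉ (⨅ (v : HeightOneSpectrum (𝓞 K)) (_ : (ℓ : 𝓞 K) ∈ v.asIdeal),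
            (W.baseChange K).torsionLocalKer (v.adicCompletion K) ((p ^ M : ℕ) : ℤ)))) ∧
      (∀ (u w : galH1Torsion (W.baseChange K) ((p ^ M : ℕ) : ℤ)) (Nu Nw : ℕ), u ≠ 0 → w ≠ 0 →
        conjAct W cK ((p ^ M : ℕ) : ℤ) u = ε • u → conjAct W cK ((p ^ M : ℕ) : ℤ) w = (-ε) • w →
        2 * Nu ≤ dp u + 1 → 2 * Nw ≤ dp w → ∀ b : ℕ, ∃ ℓ, b < ℓ ∧ (IsKolyvaginPrime N W K p ℓ ∧ FrobEqFrobInfty W K (p ^ M) ℓ) ∧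
          (((p : ℤ) ^ Nu) • u ∈ (⨅ (v : HeightOneSpectrum (𝓞 K)) (_ : (ℓ : 𝓞 K) ∈ v.asIdeal),
            (W.baseChange K).torsionLocalKer (v.adicCompletion K) ((p ^ M : ℕ) : ℤ)) ∧
            (Nu ≠ 0 → ((p : ℤ) ^ (Nu - 1)) • u ∉ (⨅ (v : HeightOneSpectrum (𝓞 K)) (_ : (ℓ : 𝓞 K) ∈ v.asIdeal),
            (W.baseChange K).torsionLocalKer (v.adicCompletion K) ((p ^ M : ℕ) : ℤ)))) ∧
          (((p : ℤ) ^ Nw) • w ∈ (⨅ (v : HeightOneSpectrum (𝓞 K)) (_ : (ℓ : 𝓞 K) ∈ v.asIdeal),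
            (W.baseChange K).torsionLocalKer (v.adicCompletion K) ((p ^ M : ℕ) : ℤ)) ∧
            (Nw ≠ 0 → ((p : ℤ) ^ (Nw - 1)) • w ∉ (⨅ (v : HeightOneSpectrum (𝓞 K)) (_ : (ℓ : 𝓞 K) ∈ v.asIdeal),
            (W.baseChange K).torsionLocalKer (v.adicCompletion K) ((p ^ M : ℕ) : ℤ))))) ∧
      (∀ (z w : galH1Torsion (W.baseChange K) ((p ^ M : ℕ) : ℤ)) (Ns Nw : ℕ), z ≠ 0 → w ≠ 0 →
        conjAct W cK ((p ^ M : ℕ) : ℤ) z = ε • z → conjAct W cK ((p ^ M : ℕ) : ℤ) w = (-ε) • w →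
        TopIndep xc z → 2 * Ns ≤ dp z + 1 → 2 * Nw ≤ dp w → ∀ b : ℕ, ∃ ℓ, b < ℓ ∧ (IsKolyvaginPrime N W K p ℓ ∧ FrobEqFrobInfty W K (p ^ M) ℓ) ∧
          xc ∈ (⨅ (v : HeightOneSpectrum (𝓞 K)) (_ : (ℓ : 𝓞 K) ∈ v.asIdeal),
            (W.baseChange K).torsionLocalKer (v.adicCompletion K) ((p ^ M : ℕ) : ℤ)) ∧
          (((p : ℤ) ^ Ns) • z ∈ (⨅ (v : HeightOneSpectrum (𝓞 K)) (_ : (ℓ : 𝓞 K) ∈ v.asIdeal),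
            (W.baseChange K).torsionLocalKer (v.adicCompletion K) ((p ^ M : ℕ) : ℤ)) ∧
            (Ns ≠ 0 → ((p : ℤ) ^ (Ns - 1)) • z ∉ (⨅ (v : HeightOneSpectrum (𝓞 K)) (_ : (ℓ : 𝓞 K) ∈ v.asIdeal),
            (W.baseChange K).torsionLocalKer (v.adicCompletion K) ((p ^ M : ℕ) : ℤ)))) ∧
          (((p : ℤ) ^ Nw) • w ∈ (⨅ (v : HeightOneSpectrum (𝓞 K)) (_ : (ℓ : 𝓞 K) ∈ v.asIdeal),
            (W.baseChange K).torsionLocalKer (v.adicCompletion K) ((p ^ M : ℕ) : ℤ)) ∧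
            (Nw ≠ 0 → ((p : ℤ) ^ (Nw - 1)) • w ∉ (⨅ (v : HeightOneSpectrum (𝓞 K)) (_ : (ℓ : 𝓞 K) ∈ v.asIdeal),
            (W.baseChange K).torsionLocalKer (v.adicCompletion K) ((p ^ M : ℕ) : ℤ))))) := by
  have hpr : p.Prime := hp.out
  have hp2 : p ≠ 2 := by omega
  have hn0 : ((p ^ M : ℕ) : ℤ) ≠ 0 := by exact_mod_cast pow_ne_zero M hpr.ne_zero
  have hinv : ∀ y, (absGaloisTransport (K := ℚ) (L := K) c₀).toRingEquiv
      ((absGaloisTransport (K := ℚ) (L := K) c₀).toRingEquiv y) = y := fun y ↦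
    RatClosure.absGaloisTransport_absGaloisTransport_of_sq_eq_one hc₀.sq_eq_one y
  -- notation-free abbreviations
  let V := galH1Torsion (W.baseChange K) ((p ^ M : ℕ) : ℤ)
  let Γ := torsionFixing (W.baseChange K) ((p ^ M : ℕ) : ℤ)
  let E := RatClosure.torsionEquiv (K := K) W ((p ^ M : ℕ) : ℤ)
  let val : V → absoluteGaloisGroup K → W.geomPoints := fun u ρ ↦
    (E.symm (h1Eval (W.baseChange K) ((p ^ M : ℕ) : ℤ) u ρ) : W.geomPoints)
  let Kol : ℕ → Prop := fun ℓ ↦ IsKolyvaginPrime N W K p ℓ ∧ FrobEqFrobInfty W K (p ^ M) ℓ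
  let A : ℕ → AddSubgroup V := fun ℓ ↦ ⨅ (v : HeightOneSpectrum (𝓞 K)) (_ : (ℓ : 𝓞 K) ∈ v.asIdeal),
    (W.baseChange K).torsionLocalKer (v.adicCompletion K) ((p ^ M : ℕ) : ℤ)
  -- `V` is killed by `p^M`; `τ` is an involution
  have htor : ∀ v : V, ((p : ℤ) ^ M) • v = 0 := fun v ↦ by
    have := zsmul_discreteH1_torsion ((p ^ M : ℕ) : ℤ) v
    exact_mod_cast this
  -- values are `p^M`-torsion, hence killed by `μ^{2M}`
  have hval2M : ∀ (u : V) ρ, (μ ^ (2 * M)) (val u ρ) = 0 := fun u ρ ↦ by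
    rw [pow_two_mul_apply W hμμ M]
    have hPM : ((p : ℤ) ^ M) • val u ρ = 0 := by
      have h1 := (mem_geomTorsion_iff W ((p ^ M : ℕ) : ℤ) _).mp
        (E.symm (h1Eval (W.baseChange K) ((p ^ M : ℕ) : ℤ) u ρ)).2
      rw [show ((p : ℤ) ^ M) = ((p ^ M : ℕ) : ℤ) by push_cast; rfl]
      exact h1
    rcases Int.natAbs_eq m with h | h <;> rw [hm] at h <;> rw [h]
    · exact hPM
    · rw [neg_pow, mul_smul, hPM, smul_zero]
  -- exact depths
  have hdepth : ∀ u : V, ∃ e : ℕ, (∀ ρ ∈ Γ, (μ ^ e) (val u ρ) = 0) ∧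
      (e = 0 ∨ ∃ ρ ∈ Γ, (μ ^ (e - 1)) (val u ρ) ≠ 0) := by
    intro u
    have hex : ∃ e : ℕ, ∀ ρ ∈ Γ, (μ ^ e) (val u ρ) = 0 := ⟨2 * M, fun ρ _ ↦ hval2M u ρ⟩
    refine ⟨Nat.find hex, Nat.find_spec hex, ?_⟩
    rcases Nat.eq_zero_or_pos (Nat.find hex) with h0 | hpos
    · exact Or.inl h0
    · right
      by_contra hall
      push Not at hall
      exact Nat.find_min hex (Nat.sub_one_lt hpos.ne') hall
  choose dp hdpk hdpx using hdepth
  -- `val (k • u) = k • val u`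
  have hvalz : ∀ (k : ℤ) (u : V) ρ, ρ ∈ Γ → val (k • u) ρ = k • val u ρ := fun k u ρ hρ ↦ by
    simp only [val, E]
    rw [h1Eval_zsmul _ _ _ _ hρ, map_zsmul, AddSubgroupClass.coe_zsmul]
  -- the dictionary `p^a u = 0 ↔ dp u ≤ 2a`
  have hdp : ∀ (u : V) (a : ℕ), ((p : ℤ) ^ a) • u = 0 ↔ dp u ≤ 2 * a := by
    intro u a
    constructor
    · intro hu
      rcases hdpx u with h0 | ⟨ρ₀, hρ₀, hρ₀top⟩
      · omega
      have h1 : ((p : ℤ) ^ a) • val u ρ₀ = 0 := by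
        rw [← hvalz _ _ _ hρ₀, hu]
        simp only [val, E]
        rw [h1Eval_zero _ _ hρ₀, map_zero, ZeroMemClass.coe_zero]
      exact (pow_zsmul_eq_zero_iff_le_two_mul W p hm hμμ (hdpk u ρ₀ hρ₀) (Or.inr hρ₀top) a).mp h1
    · intro hle
      apply eq_zero_of_forall_h1Eval_eq_zero_of_cmRamified W p K hCM h5 hram hK.1 hM
      intro ρ hρ
      have h1 : ((p : ℤ) ^ a) • val u ρ = 0 := by
        rw [pow_zsmul_eq_zero_iff_pow_two_mul_apply_eq_zero W p hm hμμ,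
          show 2 * a = (2 * a - dp u) + dp u by omega, pow_add]
        change (μ ^ (2 * a - dp u)) ((μ ^ dp u) (val u ρ)) = 0
        rw [hdpk u ρ hρ, map_zero]
      rw [← hvalz _ _ _ hρ] at h1
      have h2 : E.symm (h1Eval (W.baseChange K) ((p ^ M : ℕ) : ℤ) (((p : ℤ) ^ a) • u) ρ) = 0 :=
        Subtype.ext h1
      exact (AddEquiv.map_eq_zero_iff _).mp h2
  have hdp0 : ∀ u : V, u ≠ 0 → 0 < dp u := fun u hu ↦ by
    by_contra h
    apply hu
    have := (hdp u 0).mpr (by omega)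
    rwa [pow_zero, one_smul] at this
  have hdptop : ∀ u : V, u ≠ 0 → ∃ ρ ∈ Γ, (μ ^ (dp u - 1)) (val u ρ) ≠ 0 := fun u hu ↦ by
    rcases hdpx u with h0 | h
    · exact absurd h0 (hdp0 u hu).ne'
    · exact h
  -- uniqueness of the exact depth
  have hdpeq : ∀ (u : V) (e : ℕ), (∀ ρ ∈ Γ, (μ ^ e) (val u ρ) = 0) →
      (∃ ρ ∈ Γ, (μ ^ (e - 1)) (val u ρ) ≠ 0) → dp u = e := by
    rintro u e hek ⟨ρ₀, hρ₀, hρ₀top⟩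
    have h2 : e ≤ dp u :=
      (pow_apply_eq_zero_iff_le W (hek ρ₀ hρ₀) (Or.inr hρ₀top) (dp u)).mp (hdpk u ρ₀ hρ₀)
    have h1 : dp u ≤ e := by
      rcases hdpx u with h0 | ⟨ρ₁, hρ₁, hρ₁top⟩
      · omega
      · exact (pow_apply_eq_zero_iff_le W (hdpk u ρ₁ hρ₁) (Or.inr hρ₁top) e).mp (hek ρ₁ hρ₁)
    omega
  -- `xc`: non-zero, depth `≥ 2M − 1`
  have hx0 : xc ≠ 0 := fun h ↦ hxord (by rw [h, zsmul_zero])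
  have hdpxM : 2 * M ≤ dp xc + 1 := by
    have : ¬ dp xc ≤ 2 * (M - 1) := fun h ↦ hxord ((hdp xc (M - 1)).mpr h)
    omega
  have hdpleM : ∀ u : V, dp u ≤ 2 * M := fun u ↦ (hdp u M).mp (htor u)
  -- Kolyvagin primes and strict kernels: packaging of the conclusions of FILE 7′
  have hpack : ∀ {ℓ : ℕ}, ℓ.Prime → ¬ ℓ ∣ N → ¬ ((ℓ : ℤ) ∣ NumberField.discr K) → ℓ ≠ p →
      (Ideal.span {(ℓ : 𝓞 K)}).IsPrime → FrobEqFrobInfty W K (p ^ M) ℓ → Kol ℓ :=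
    fun hℓ hℓN hℓD hℓp hprime hfrob ↦
      ⟨⟨hℓ, hℓN, hℓD, hℓp, hprime, hfrob.of_dvd (dvd_pow_self p (by omega))⟩, hfrob⟩
  have hAmem : ∀ {ℓ : ℕ} {u : V}, (∀ v : HeightOneSpectrum (𝓞 K), (ℓ : 𝓞 K) ∈ v.asIdeal →
      u ∈ (W.baseChange K).torsionLocalKer (v.adicCompletion K) ((p ^ M : ℕ) : ℤ)) → u ∈ A ℓ :=
    fun h ↦ AddSubgroup.mem_iInf.mpr fun v ↦ AddSubgroup.mem_iInf.mpr fun hv ↦ h v hv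
  have hAnot : ∀ {ℓ : ℕ} {u : V}, Kol ℓ → (∀ v : HeightOneSpectrum (𝓞 K), (ℓ : 𝓞 K) ∈ v.asIdeal →
      u ∉ (W.baseChange K).torsionLocalKer (v.adicCompletion K) ((p ^ M : ℕ) : ℤ)) → u ∉ A ℓ :=
    fun hℓ h hmem ↦ h hℓ.1.place hℓ.1.mem_place
      (AddSubgroup.mem_iInf.mp (AddSubgroup.mem_iInf.mp hmem hℓ.1.place) hℓ.1.mem_place)
  -- top independence of a pair, in the `dp` currency
  let TopIndep : V → V → Prop := fun u z ↦ z = 0 ∨ ∀ a b : ℤ, (∀ ρ ∈ Γ,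
      a • (μ ^ (dp u - 1)) (val u ρ) + b • (μ ^ (dp z - 1)) (val z ρ) = 0) → (p : ℤ) ∣ a ∧ (p : ℤ) ∣ b
  -- (B4) the split
  have hsplit : ∀ z : V, conjAct W cK ((p ^ M : ℕ) : ℤ) z = ε • z →
      ∃ (k : ℤ) (z' : V), z = k • xc + z' ∧ TopIndep xc z' := by
    intro z _
    obtain ⟨k, e', -, hk, hrest⟩ := exists_sub_zsmul_top_indep W p hs hm hμμ hanti hp2 hKp
      ((p ^ M : ℕ) : ℤ) xc (ex := dp xc) (hdp0 xc hx0) (hdpk xc) (hdptop xc hx0) (dp z)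
      (by have := hdpleM z; omega) z (hdpk z)
    refine ⟨k, z - k • xc, by abel, ?_⟩
    rcases hrest with h0 | ⟨-, htop, hind⟩
    · left
      subst h0
      apply eq_zero_of_forall_h1Eval_eq_zero_of_cmRamified W p K hCM h5 hram hK.1 hM
      intro ρ hρ
      have h1 : val (z - k • xc) ρ = 0 := by
        have := hk ρ hρ
        rwa [pow_zero] at this
      have h2 : E.symm (h1Eval (W.baseChange K) ((p ^ M : ℕ) : ℤ) (z - k • xc) ρ) = 0 := Subtype.ext h1
      exact (AddEquiv.map_eq_zero_iff _).mp h2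
    · have hde : dp (z - k • xc) = e' := hdpeq (z - k • xc) e' hk htop
      exact Or.inr (by rw [hde]; exact hind)
  -- (B1)
  have hceb1 : ∀ (u : V) (Nu : ℕ), u ≠ 0 → conjAct W cK ((p ^ M : ℕ) : ℤ) u = ε • u →
      2 * Nu ≤ dp u + 1 → ∀ b : ℕ, ∃ ℓ, b < ℓ ∧ Kol ℓ ∧ ((p : ℤ) ^ Nu) • u ∈ A ℓ ∧
        (Nu ≠ 0 → ((p : ℤ) ^ (Nu - 1)) • u ∉ A ℓ) := by
    intro u Nu hu hτu hNu b
    obtain ⟨ℓ, hbℓ, hℓ, hℓN, hℓD, hℓp, hprime, hfrob, hloc⟩ :=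
      exists_kolyvaginPrime_gt_pow_requests_single W p hC (N := N) hCM h5 hram hs hm hμμ hcomm hanti hK hM
        hc₀ ht hε hη (ν := ε) hτu (ey := dp u) (hdpk u) (hdptop u hu) (Ny := Nu) (Or.inl ⟨rfl, hNu⟩) b
    have hK' := hpack hℓ hℓN hℓD hℓp hprime hfrob
    exact ⟨ℓ, hbℓ, hK', hAmem fun v hv ↦ (hloc v hv).1,
      fun hN ↦ hAnot hK' fun v hv ↦ (hloc v hv).2 hN⟩
  -- (B2)
  have hceb2 : ∀ (u w : V) (Nu Nw : ℕ), u ≠ 0 → w ≠ 0 → conjAct W cK ((p ^ M : ℕ) : ℤ) u = ε • u →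
      conjAct W cK ((p ^ M : ℕ) : ℤ) w = (-ε) • w → 2 * Nu ≤ dp u + 1 → 2 * Nw ≤ dp w → ∀ b : ℕ,
      ∃ ℓ, b < ℓ ∧ Kol ℓ ∧
        (((p : ℤ) ^ Nu) • u ∈ A ℓ ∧ (Nu ≠ 0 → ((p : ℤ) ^ (Nu - 1)) • u ∉ A ℓ)) ∧
        (((p : ℤ) ^ Nw) • w ∈ A ℓ ∧ (Nw ≠ 0 → ((p : ℤ) ^ (Nw - 1)) • w ∉ A ℓ)) := by
    intro u w Nu Nw hu hw hτu hτw hNu hNw b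
    obtain ⟨ℓ, hbℓ, hℓ, hℓN, hℓD, hℓp, hprime, hfrob, hloc⟩ :=
      exists_kolyvaginPrime_gt_pow_requests_pair_of_opposite_sign W p hC (N := N) hCM h5 hram hs hm hμμ
        hcomm hanti hK hKp hM hc₀ ht hε hη hτu hτw (hdp0 u hu) (hdp0 w hw) (hdpk u) (hdpk w) (hdptop u hu)
        (hdptop w hw) hNu hNw b
    have hK' := hpack hℓ hℓN hℓD hℓp hprime hfrob
    exact ⟨ℓ, hbℓ, hK',
      ⟨hAmem fun v hv ↦ ((hloc v hv).1).1, fun hN ↦ hAnot hK' fun v hv ↦ ((hloc v hv).1).2 hN⟩,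
      ⟨hAmem fun v hv ↦ ((hloc v hv).2).1, fun hN ↦ hAnot hK' fun v hv ↦ ((hloc v hv).2).2 hN⟩⟩
  -- (B3)
  have hceb3 : ∀ (z w : V) (Ns Nw : ℕ), z ≠ 0 → w ≠ 0 → conjAct W cK ((p ^ M : ℕ) : ℤ) z = ε • z →
      conjAct W cK ((p ^ M : ℕ) : ℤ) w = (-ε) • w → TopIndep xc z → 2 * Ns ≤ dp z + 1 → 2 * Nw ≤ dp w →
      ∀ b : ℕ, ∃ ℓ, b < ℓ ∧ Kol ℓ ∧ xc ∈ A ℓ ∧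
        (((p : ℤ) ^ Ns) • z ∈ A ℓ ∧ (Ns ≠ 0 → ((p : ℤ) ^ (Ns - 1)) • z ∉ A ℓ)) ∧
        (((p : ℤ) ^ Nw) • w ∈ A ℓ ∧ (Nw ≠ 0 → ((p : ℤ) ^ (Nw - 1)) • w ∉ A ℓ)) := by
    intro z w Ns Nw hz hw hτz hτw hind hNs hNw b
    have hind' : ∀ a b : ℤ, (∀ ρ ∈ Γ,
        a • (μ ^ (dp xc - 1)) (val xc ρ) + b • (μ ^ (dp z - 1)) (val z ρ) = 0) → (p : ℤ) ∣ a ∧ (p : ℤ) ∣ b := by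
      rcases hind with h0 | h
      · exact absurd h0 hz
      · exact h
    obtain ⟨ℓ, hbℓ, hℓ, hℓN, hℓD, hℓp, hprime, hfrob, hloc⟩ :=
      exists_kolyvaginPrime_gt_pow_requests_triple W p hC (N := N) hCM h5 hram hs hm hμμ hcomm hanti hK hKp
        hM hc₀ ht hε hη hτx hτz hτw (hdpk xc) (hdpk z) (hdpk w) (hdptop w hw) hind' hNs hNw b
    have hK' := hpack hℓ hℓN hℓD hℓp hprime hfrob
    exact ⟨ℓ, hbℓ, hK', hAmem fun v hv ↦ (hloc v hv).1,
      ⟨hAmem fun v hv ↦ ((hloc v hv).2.1).1, fun hN ↦ hAnot hK' fun v hv ↦ ((hloc v hv).2.1).2 hN⟩,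
      ⟨hAmem fun v hv ↦ ((hloc v hv).2.2).1, fun hN ↦ hAnot hK' fun v hv ↦ ((hloc v hv).2.2).2 hN⟩⟩
  exact ⟨dp, TopIndep, hdp, hdpeq, hsplit, hceb1, hceb2, hceb3⟩

/-- **McCallum's exponent VERBATIM on the `ε`-part at the Borel prime, under one even-depth derived class.** In the
setting of `pow_zsmul_mem_zmultiples_of_cmRamified` (`…BorelDescentAssembly`): if some Kolyvagin prime `ℓ` of level
`p^M` with `p^{M−M₀−1} c(ℓ) ∉ Loc λ` (`ord d(ℓ)_λ = p^{M−M₀}`, a step-A prime) carries a class `c(ℓ)` of EVEN exact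
`𝓞`-depth `e` (`μ^e` kills its values, `μ^{e−1}` does not), then for every `s ∈ Sel` and `u ∈ ℤ` the `ε`-component
satisfies `p^{2M₀}·(u(s + ε c_* s)) ∈ ℤx`. [cite: GrossLMS1991, §10 Claim 10.3] [cite: McCallumLMS1991, §5] -/
theorem pow_zsmul_eigen_mem_zmultiples_of_cmRamified_of_even
    (hC : Literature.NumberTheory.Automorphic.chebotarev_artinRep) {N : ℕ} [NeZero N]
    (hCM : W.HasCM) (h5 : 5 ≤ p) (hram : CMRamified W p)
    {s₀ : AlgebraicClosure ℚ} {μ : AddMonoid.End W.geomPoints} {m : ℤ}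
    (hs : s₀ ^ 2 = ((-(p : ℤ) : ℤ) : AlgebraicClosure ℚ)) (hm : m.natAbs = p)
    (hμμ : ∀ P, μ (μ P) = m • P)
    (hcomm : ∀ g : absoluteGaloisGroup ℚ, g • s₀ = s₀ → ∀ P, μ (g • P) = g • μ P)
    (hanti : ∀ g : absoluteGaloisGroup ℚ, g • s₀ = -s₀ → ∀ P, μ (g • P) = -(g • μ P))
    (hK : IsImaginaryQuadratic K) (hKp : ∀ y : K, y ^ 2 ≠ -(p : K)) {M : ℕ} (hM : 1 ≤ M)
    {cK : K ≃ₐ[ℚ] K} {c₀ : absoluteGaloisGroup ℚ} (hc₀ : IsComplexConjugation (Rat.castHom ℝ) c₀)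
    (ht : IsLiftOfAut cK (absGaloisTransport (K := ℚ) (L := K) c₀).toRingEquiv) (hcc : cK * cK = 1)
    {ε : ℤ} (hε : ε = 1 ∨ ε = -1) (hη : ∀ P : W.geomPoints, μ P = 0 → c₀ • P = ε • P)
    -- the displayed non-Čebotarev data on `V = H¹(K, W[p^M])`
    (Sel : AddSubgroup (galH1Torsion (W.baseChange K) ((p ^ M : ℕ) : ℤ)))
    (Loc : Pl → AddSubgroup (galH1Torsion (W.baseChange K) ((p ^ M : ℕ) : ℤ)))
    (pl : ℕ → Pl) (Dv : Pl → ℕ → Prop)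
    (hτSel : ∀ s ∈ Sel, conjAct W cK ((p ^ M : ℕ) : ℤ) s ∈ Sel) (hSel : ∀ s, s ∈ Sel ↔ ∀ v, s ∈ Loc v)
    (hdv : ∀ ℓ, (IsKolyvaginPrime N W K p ℓ ∧ FrobEqFrobInfty W K (p ^ M) ℓ) → ∀ v, Dv v ℓ ↔ v = pl ℓ)
    (hdvm : ∀ ℓ ℓ', (IsKolyvaginPrime N W K p ℓ ∧ FrobEqFrobInfty W K (p ^ M) ℓ) →
      (IsKolyvaginPrime N W K p ℓ' ∧ FrobEqFrobInfty W K (p ^ M) ℓ') → ∀ v, Dv v (ℓ * ℓ') → Dv v ℓ ∨ Dv v ℓ')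
    {xc : galH1Torsion (W.baseChange K) ((p ^ M : ℕ) : ℤ)} (hxSel : xc ∈ Sel)
    (hxord : ((p : ℤ) ^ (M - 1)) • xc ≠ 0) (hτx : conjAct W cK ((p ^ M : ℕ) : ℤ) xc = ε • xc) {M₀ : ℕ}
    (cl : ℕ → galH1Torsion (W.baseChange K) ((p ^ M : ℕ) : ℤ)) (hc1 : cl 1 = ((p : ℤ) ^ M₀) • xc)
    (hτc : ∀ n, KolSupp (fun ℓ ↦ IsKolyvaginPrime N W K p ℓ ∧ FrobEqFrobInfty W K (p ^ M) ℓ) n →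
      conjAct W cK ((p ^ M : ℕ) : ℤ) (cl n) = (ε * (-1) ^ n.primeFactors.card) • cl n)
    (hcloc : ∀ n, KolSupp (fun ℓ ↦ IsKolyvaginPrime N W K p ℓ ∧ FrobEqFrobInfty W K (p ^ M) ℓ) n →
      ∀ v, ¬ Dv v n → cl n ∈ Loc v)
    (hc44 : ∀ ℓ n, (IsKolyvaginPrime N W K p ℓ ∧ FrobEqFrobInfty W K (p ^ M) ℓ) →
      KolSupp (fun ℓ ↦ IsKolyvaginPrime N W K p ℓ ∧ FrobEqFrobInfty W K (p ^ M) ℓ) (ℓ * n) → ∀ a : ℕ,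
      (((p : ℤ) ^ a) • cl (ℓ * n) ∈ Loc (pl ℓ)) ↔
        ((p : ℤ) ^ a) • cl n ∈ ⨅ (v : HeightOneSpectrum (𝓞 K)) (_ : (ℓ : 𝓞 K) ∈ v.asIdeal),
          (W.baseChange K).torsionLocalKer (v.adicCompletion K) ((p ^ M : ℕ) : ℤ))
    (hdual : ∀ ℓ, (IsKolyvaginPrime N W K p ℓ ∧ FrobEqFrobInfty W K (p ^ M) ℓ) → ∀ ν : ℤ,
      (ν = 1 ∨ ν = -1) → ∀ d, conjAct W cK ((p ^ M : ℕ) : ℤ) d = ν • d → (∀ v, v ≠ pl ℓ → d ∈ Loc v) →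
      ∀ s ∈ Sel, conjAct W cK ((p ^ M : ℕ) : ℤ) s = ν • s → ∀ a, a < M →
      ((p : ℤ) ^ a) • d ∉ Loc (pl ℓ) →
        ((p : ℤ) ^ (M - 1 - a)) • s ∈ ⨅ (v : HeightOneSpectrum (𝓞 K)) (_ : (ℓ : 𝓞 K) ∈ v.asIdeal),
          (W.baseChange K).torsionLocalKer (v.adicCompletion K) ((p ^ M : ℕ) : ℤ))
    {ℓ : ℕ} (hℓ : IsKolyvaginPrime N W K p ℓ ∧ FrobEqFrobInfty W K (p ^ M) ℓ)
    (hd : ((p : ℤ) ^ (M - M₀ - 1)) • cl ℓ ∉ Loc (pl ℓ)) {e : ℕ} (heven : Even e)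
    (hce : ∀ ρ ∈ torsionFixing (W.baseChange K) ((p ^ M : ℕ) : ℤ), (μ ^ e) ((RatClosure.torsionEquiv (K := K) W ((p ^ M : ℕ) : ℤ)).symm
          (h1Eval (W.baseChange K) ((p ^ M : ℕ) : ℤ) (cl ℓ) ρ) : W.geomPoints) = 0)
    (hctop : ∃ ρ ∈ torsionFixing (W.baseChange K) ((p ^ M : ℕ) : ℤ), (μ ^ (e - 1)) ((RatClosure.torsionEquiv (K := K) W ((p ^ M : ℕ) : ℤ)).symm
          (h1Eval (W.baseChange K) ((p ^ M : ℕ) : ℤ) (cl ℓ) ρ) : W.geomPoints) ≠ 0)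
    (u : ℤ) {s : galH1Torsion (W.baseChange K) ((p ^ M : ℕ) : ℤ)} (hsSel : s ∈ Sel) :
    ((p : ℤ) ^ (2 * M₀)) • (u • (s + ε • conjAct W cK ((p ^ M : ℕ) : ℤ) s)) ∈ AddSubgroup.zmultiples xc := by
  obtain ⟨dp, TopIndep, hdp, hdpeq, hsplit, -, -, hceb3⟩ :=
    exists_borelCebotarevData_of_cmRamified W p hC (N := N) hCM h5 hram hs hm hμμ hcomm hanti hK hKp hM hc₀ ht hε hη
      hxord hτx
  have htor : ∀ v : galH1Torsion (W.baseChange K) ((p ^ M : ℕ) : ℤ), ((p : ℤ) ^ M) • v = 0 := fun v ↦ by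
    have := zsmul_discreteH1_torsion ((p ^ M : ℕ) : ℤ) v
    exact_mod_cast this
  have hττ := conjAct_conjAct_of_mul_self W hcc ((p ^ M : ℕ) : ℤ)
  have hKolp : ∀ ℓ, (IsKolyvaginPrime N W K p ℓ ∧ FrobEqFrobInfty W K (p ^ M) ℓ) → ℓ.Prime :=
    fun ℓ h ↦ h.1.prime
  have hde : Even (dp (cl ℓ)) := by rw [hdpeq (cl ℓ) e hce hctop]; exact heven
  exact pow_zsmul_eigen_mem_zmultiples_borel_of_even
    (Kol := fun ℓ ↦ IsKolyvaginPrime N W K p ℓ ∧ FrobEqFrobInfty W K (p ^ M) ℓ)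
    (A := fun ℓ ↦ ⨅ (v : HeightOneSpectrum (𝓞 K)) (_ : (ℓ : 𝓞 K) ∈ v.asIdeal),
      (W.baseChange K).torsionLocalKer (v.adicCompletion K) ((p ^ M : ℕ) : ℤ))
    (dp := dp) (TopIndep := TopIndep) hε htor hττ hτSel hSel hKolp hdv hdvm hxSel hτx hc1 hτc hcloc hc44 hdual
    hdp hsplit hceb3 hℓ hd hde u hsSel

end Summit.BirchSwinnertonDyer.BirchSwinnertonDyer.Theorems.PrintCFram.BorelKolyvaginPairing

end
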